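import Summits.ResolutionOfSingularities.ResolutionOfSingularities.Theorems.FrobeniusLadderFInjectiveMacaulayficationPointFixableOfGoodTower
import HarnessLib

/-!
# Point-supported towers ITERATE: two point-supported steps compose to one, and the one-shot case
# (crux `FInjectiveMacaulayfication`, T-𝒫-loc 5h — iteration form, ruling R12.10 (c))

[OURS · L1 W4.5a · res-L1-w45a-stub-3] Support file (`--supports stmt-ResolutionOfSingularities-15315 --as helper`) for the crux
`FrobeniusLadder.FInjectiveMacaulayfication`; NOT a statement of any manuscript; AI-written, weaker than expert review.

5h `PointFixableOfGoodTower.pointFixable_of_goodTower` (p512998; strat-1's PFixTowerSig r2 b235fde4a11e66a6 §T1) reads a GOOD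
TWO-STEP point-supported tower as a `P_loc`-certificate `PFix (𝒪_{X,b})`. Ruling R12.10 (c) asks that it ITERATE (idea-1's
normalised Zariski–Lipman towers have 3–8 steps). This file gives the 2-step form + `_cons`:

* `exists_isBlowup_comp_pointSupported` — **CONS**: a blowing up `π₁` along `J₁` (finite type, `≠ ⊥`, `Supp J₁ = {b}`) followed by
  a blowing up `π₂` of `X'` along `J₂` (finite type, `≠ ⊥`, `Supp J₂ ⊆ π₁⁻¹(b)`) IS a blowing up of `X` along SOME `J` of finite type
  with `J ≠ ⊥` and `Supp J = {b}` — Stacks 080B in the tree (`IsBlowup.exists_isBlowup_comp_mul_of_fg`, `J = J₁·R`), `J ≠ ⊥` because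
  `X''` is integral (`IsBlowup.isIntegral`, `IsBlowup.isEmpty_of_bot`). So a k-step tower all of whose centres lie over `b`
  collapses, step by step, to the hypotheses of `pointFixable_of_goodTower` (or of the one-shot form below).
* `pointFixable_of_goodBlowup` — **ONE-SHOT**: a single blowing up along a point-supported `J₁` of finite type, good at every point
  over `b`, gives `PFix (𝒪_{X,b})` (5h with `J₂ = ⊤`, `π₂ = 𝟙`, `isBlowup_id_top`). This is the shape of every confirmed K-loc
  specimen (T₁₁⁺ at p = 7, 11, 13: one toric modification good over 0, R12.9 (a)).
* `pointFixable_of_goodThreeStepTower` — the 3-step instance of the iteration (cons + 5h), as a template.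
-/

-- single-problem summit: the doubled namespace component is forced
set_option linter.dupNamespace false

noncomputable section

namespace Summit.ResolutionOfSingularities.ResolutionOfSingularities.Theorems.FInjectiveMacaulayfication.PointFixableTowerCons

open AlgebraicGeometry CategoryTheory CategoryTheory.Limits Literature.AlgebraicGeometry.Resolution TopologicalSpace IsLocalRing
open Summit.ResolutionOfSingularities.ResolutionOfSingularities.Theorems.FInjectiveMacaulayfication

/-- **CONS — two point-supported steps are one point-supported step.** [cite: StacksProject, Tag 080B] -/
theorem exists_isBlowup_comp_pointSupported (X : Scheme.{0}) [CompactSpace X] [QuasiSeparatedSpace X] [IsIntegral X]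
    (b : X) (J₁ : X.IdealSheafData) (hJ₁fg : ∀ U : X.affineOpens, (J₁.ideal U).FG) (hJ₁ : J₁ ≠ ⊥)
    (hsupp₁ : (J₁.support : Set X) = {b}) (X' : Scheme.{0}) (π₁ : X' ⟶ X) (hπ₁ : IsBlowup π₁ J₁)
    (J₂ : X'.IdealSheafData) (hJ₂fg : ∀ U : X'.affineOpens, (J₂.ideal U).FG) (hJ₂ : J₂ ≠ ⊥)
    (hsupp₂ : (J₂.support : Set X') ⊆ π₁.base ⁻¹' {b}) (X'' : Scheme.{0}) (π₂ : X'' ⟶ X') (hπ₂ : IsBlowup π₂ J₂) :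
    ∃ J : X.IdealSheafData, (∀ U : X.affineOpens, (J.ideal U).FG) ∧ J ≠ ⊥ ∧ (J.support : Set X) = {b} ∧
      IsBlowup (π₂ ≫ π₁) J := by
  obtain ⟨R, hRfg, hπ, hsuppJ⟩ := hπ₁.exists_isBlowup_comp_mul_of_fg hJ₁fg hπ₂ hJ₂fg
  have hJfg : ∀ U : X.affineOpens, ((J₁ * R).ideal U).FG := fun U => by
    rw [Scheme.IdealSheafData.ideal_mul, Pi.mul_apply]
    exact (hJ₁fg U).mul (hRfg U)
  have hsub : ((J₁ * R).support : Set X) ⊆ {b} := by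
    intro y hy
    rcases hsuppJ hy with h | ⟨y', hy', rfl⟩
    · rwa [hsupp₁] at h
    · exact hsupp₂ hy'
  have hle : J₁ * R ≤ J₁ := Scheme.IdealSheafData.le_def.mpr fun U => by
    rw [Scheme.IdealSheafData.ideal_mul, Pi.mul_apply]
    exact Ideal.mul_le_right
  have hbJ : b ∈ ((J₁ * R).support : Set X) := by
    have h1 : b ∈ (J₁.support : Set X) := by rw [hsupp₁]; exact Set.mem_singleton b
    exact Scheme.IdealSheafData.support_antitone hle h1
  haveI : IsIntegral X' := hπ₁.isIntegral hJ₁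
  haveI : IsIntegral X'' := hπ₂.isIntegral hJ₂
  have hJ : J₁ * R ≠ ⊥ := by
    intro h0
    rw [h0] at hπ
    exact (IsBlowup.isEmpty_of_bot hπ).false (Classical.arbitrary X'')
  exact ⟨J₁ * R, hJfg, hJ, Set.Subset.antisymm hsub (Set.singleton_subset_iff.mpr hbJ), hπ⟩

set_option maxHeartbeats 800000 in
-- the ∃-packaged clause elaborates large terms
/-- **ONE-SHOT — a single good point-supported blowing up is a `P_loc`-certificate**: `X` quasi-compact quasi-separated integral
locally Noetherian, `b` closed, `π₁` a blowing up along `J₁` of finite type with `J₁ ≠ ⊥`, `Supp J₁ = {b}`, and the full clause at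
every point of `X'` over `b` ⟹ `PFix (𝒪_{X,b})` (5h with `J₂ = ⊤`, `π₂ = 𝟙 X'`). [folklore] -/
theorem pointFixable_of_goodBlowup (p : ℕ) (X : Scheme.{0}) [CompactSpace X] [QuasiSeparatedSpace X] [IsIntegral X]
    [IsLocallyNoetherian X] (b : X) (hb : IsClosed ({b} : Set X))
    (J₁ : X.IdealSheafData) (hJ₁fg : ∀ U : X.affineOpens, (J₁.ideal U).FG) (hJ₁ : J₁ ≠ ⊥)
    (hsupp₁ : (J₁.support : Set X) = {b}) (X' : Scheme.{0}) (π₁ : X' ⟶ X) (hπ₁ : IsBlowup π₁ J₁)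
    (hgood : ∀ x' : X', π₁.base x' = b → IsDomain (X'.presheaf.stalk x') ∧ ∀ d : ℕ, ringKrullDim (X'.presheaf.stalk x') = d → ∀ s : Fin d → X'.presheaf.stalk x', (Ideal.span (Set.range s)).radical.IsMaximal → RingTheory.Sequence.IsWeaklyRegular (X'.presheaf.stalk x') (List.ofFn s) ∧ ∀ y : X'.presheaf.stalk x', (∃ e : ℕ, y ^ p ^ e ∈ Ideal.span ((fun z : X'.presheaf.stalk x' => z ^ p ^ e) '' (Ideal.span (Set.range s) : Set (X'.presheaf.stalk x')))) → y ∈ Ideal.span (Set.range s)) :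
    (∃ (n : ℕ) (c : Fin n → X.presheaf.stalk b), Ideal.span (Set.range c) ≠ ⊥ ∧ (Ideal.span (Set.range c)).radical = IsLocalRing.maximalIdeal (X.presheaf.stalk b) ∧
        ∀ (j : Fin n) (𝔔 : PrimeSpectrum (Literature.AlgebraicGeometry.Resolution.blowupAlgebra (Ideal.span (Set.range c)) (c j))),
          𝔔.asIdeal.comap (algebraMap (X.presheaf.stalk b) (Literature.AlgebraicGeometry.Resolution.blowupAlgebra (Ideal.span (Set.range c)) (c j))) = IsLocalRing.maximalIdeal (X.presheaf.stalk b) →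
          IsDomain (Localization.AtPrime 𝔔.asIdeal) ∧ ∀ d : ℕ, ringKrullDim (Localization.AtPrime 𝔔.asIdeal) = d → ∀ s : Fin d → Localization.AtPrime 𝔔.asIdeal, (Ideal.span (Set.range s)).radical.IsMaximal → RingTheory.Sequence.IsWeaklyRegular (Localization.AtPrime 𝔔.asIdeal) (List.ofFn s) ∧ ∀ y : Localization.AtPrime 𝔔.asIdeal, (∃ e : ℕ, y ^ p ^ e ∈ Ideal.span ((fun z : Localization.AtPrime 𝔔.asIdeal => z ^ p ^ e) '' (Ideal.span (Set.range s) : Set (Localization.AtPrime 𝔔.asIdeal)))) → y ∈ Ideal.span (Set.range s)) := by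
  haveI : IsIntegral X' := hπ₁.isIntegral hJ₁
  have htop : (⊤ : X'.IdealSheafData) ≠ ⊥ := by
    intro h
    have hs := congrArg Scheme.IdealSheafData.support h
    rw [Scheme.IdealSheafData.support_top, Scheme.IdealSheafData.support_bot] at hs
    have hx : (Classical.arbitrary X') ∈ ((⊤ : Closeds X') : Set X') := trivial
    rw [← hs] at hx
    exact hx
  refine PointFixableOfGoodTower.pointFixable_of_goodTower p X b hb J₁ hJ₁fg hJ₁ hsupp₁ X' π₁ hπ₁ ⊤
    (fun U => by rw [Scheme.IdealSheafData.ideal_top, Pi.top_apply]; exact Module.Finite.fg_top) htop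
    (by rw [Scheme.IdealSheafData.support_top]; exact Set.empty_subset _) X' (𝟙 X') (isBlowup_id_top X') ?_
  intro x'' hx''
  exact hgood x'' hx''

set_option maxHeartbeats 800000 in
-- as above
/-- **THREE STEPS — the iteration template**: a point-supported 3-step tower good over `b` at the top gives `PFix (𝒪_{X,b})` —
`exists_isBlowup_comp_pointSupported` collapses the first two steps, then 5h. Longer towers: repeat the cons. [folklore] -/
theorem pointFixable_of_goodThreeStepTower (p : ℕ) (X : Scheme.{0}) [CompactSpace X] [QuasiSeparatedSpace X] [IsIntegral X]
    [IsLocallyNoetherian X] (b : X) (hb : IsClosed ({b} : Set X))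
    (J₁ : X.IdealSheafData) (hJ₁fg : ∀ U : X.affineOpens, (J₁.ideal U).FG) (hJ₁ : J₁ ≠ ⊥)
    (hsupp₁ : (J₁.support : Set X) = {b}) (X' : Scheme.{0}) (π₁ : X' ⟶ X) (hπ₁ : IsBlowup π₁ J₁)
    (J₂ : X'.IdealSheafData) (hJ₂fg : ∀ U : X'.affineOpens, (J₂.ideal U).FG) (hJ₂ : J₂ ≠ ⊥)
    (hsupp₂ : (J₂.support : Set X') ⊆ π₁.base ⁻¹' {b}) (X'' : Scheme.{0}) (π₂ : X'' ⟶ X') (hπ₂ : IsBlowup π₂ J₂)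
    (J₃ : X''.IdealSheafData) (hJ₃fg : ∀ U : X''.affineOpens, (J₃.ideal U).FG) (hJ₃ : J₃ ≠ ⊥)
    (hsupp₃ : (J₃.support : Set X'') ⊆ (π₂ ≫ π₁).base ⁻¹' {b}) (X₃ : Scheme.{0}) (π₃ : X₃ ⟶ X'') (hπ₃ : IsBlowup π₃ J₃)
    (hgood : ∀ x₃ : X₃, π₁.base (π₂.base (π₃.base x₃)) = b → IsDomain (X₃.presheaf.stalk x₃) ∧ ∀ d : ℕ, ringKrullDim (X₃.presheaf.stalk x₃) = d → ∀ s : Fin d → X₃.presheaf.stalk x₃, (Ideal.span (Set.range s)).radical.IsMaximal → RingTheory.Sequence.IsWeaklyRegular (X₃.presheaf.stalk x₃) (List.ofFn s) ∧ ∀ y : X₃.presheaf.stalk x₃, (∃ e : ℕ, y ^ p ^ e ∈ Ideal.span ((fun z : X₃.presheaf.stalk x₃ => z ^ p ^ e) '' (Ideal.span (Set.range s) : Set (X₃.presheaf.stalk x₃)))) → y ∈ Ideal.span (Set.range s)) :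
    (∃ (n : ℕ) (c : Fin n → X.presheaf.stalk b), Ideal.span (Set.range c) ≠ ⊥ ∧ (Ideal.span (Set.range c)).radical = IsLocalRing.maximalIdeal (X.presheaf.stalk b) ∧
        ∀ (j : Fin n) (𝔔 : PrimeSpectrum (Literature.AlgebraicGeometry.Resolution.blowupAlgebra (Ideal.span (Set.range c)) (c j))),
          𝔔.asIdeal.comap (algebraMap (X.presheaf.stalk b) (Literature.AlgebraicGeometry.Resolution.blowupAlgebra (Ideal.span (Set.range c)) (c j))) = IsLocalRing.maximalIdeal (X.presheaf.stalk b) →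
          IsDomain (Localization.AtPrime 𝔔.asIdeal) ∧ ∀ d : ℕ, ringKrullDim (Localization.AtPrime 𝔔.asIdeal) = d → ∀ s : Fin d → Localization.AtPrime 𝔔.asIdeal, (Ideal.span (Set.range s)).radical.IsMaximal → RingTheory.Sequence.IsWeaklyRegular (Localization.AtPrime 𝔔.asIdeal) (List.ofFn s) ∧ ∀ y : Localization.AtPrime 𝔔.asIdeal, (∃ e : ℕ, y ^ p ^ e ∈ Ideal.span ((fun z : Localization.AtPrime 𝔔.asIdeal => z ^ p ^ e) '' (Ideal.span (Set.range s) : Set (Localization.AtPrime 𝔔.asIdeal)))) → y ∈ Ideal.span (Set.range s)) := by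
  obtain ⟨J, hJfg, hJ, hsupp, hπ⟩ := exists_isBlowup_comp_pointSupported X b J₁ hJ₁fg hJ₁ hsupp₁ X' π₁ hπ₁ J₂ hJ₂fg hJ₂
    hsupp₂ X'' π₂ hπ₂
  refine PointFixableOfGoodTower.pointFixable_of_goodTower p X b hb J hJfg hJ hsupp X'' (π₂ ≫ π₁) hπ J₃ hJ₃fg hJ₃ hsupp₃
    X₃ π₃ hπ₃ ?_
  intro x₃ hx₃
  refine hgood x₃ ?_
  rw [← Scheme.Hom.comp_apply]
  exact hx₃

end Summit.ResolutionOfSingularities.ResolutionOfSingularities.Theorems.FInjectiveMacaulayfication.PointFixableTowerCons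

end
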